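import Mathlib
import Literature.MathematicalPhysics.QuantumManyBody.PeriodicBoseGasFourier
import Literature.MathematicalPhysics.QuantumManyBody.PeriodicBoseGasLemma33
import Literature.MathematicalPhysics.QuantumManyBody.PeriodicBoseGasThm31
import Literature.MathematicalPhysics.QuantumManyBody.WeightedCorrector

/-!
# Coherent-state forms `F(u_c) = ∫_{Λ^N} ∏ⱼ conj u_c(xⱼ) Ψ` on the periodic cell: expansion,
positivity domination, measurability, and the plane-wave modes

Helper file for route `BECHusimiAmplitudeGas`, support item `LaplaceCapUnion`
(stmt-AtomisticToContinuum-11995). For a finite family of one-body modes `e : ι → (ℝ³ → ℂ)`,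
`u_c = ∑ᵢ cᵢ eᵢ` and a continuous `Ψ` on `Λ^N = [0,L)^{3N}`:

* `form_expansion`: `F(u_c) = ∑_{f : Fin N → ι} (∏ⱼ conj c_{f j}) A_f`,
  `A_f = ∫_{Λ^N} ∏ⱼ conj e_{f j}(xⱼ) Ψ` (an antiholomorphic form of degree `N` in `c`);
* `norm_form_integral_le_abs`: `|F(g)| ≤ |F(|g|)|` when `Ψ ≥ 0`;
* measurability in `c` of `F(|u_c|)` and of the constant-mode overlap of `|u_c|`;
* for the normalised plane waves `eᵢ = e_{nᵢ}/√(L³)` of the cube `|n_k| ≤ R`: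
  `⟨u_c, φ₀⟩ = conj c_{i₀}` (`i₀` the zero mode), `A_{(i₀,…,i₀)} = F(φ₀)`, and `F(φ₀) ≠ 0` for
  `Ψ ≥ 0` normalised.
-/

noncomputable section

open MeasureTheory Set
open scoped ENNReal NNReal ComplexConjugate
open Literature.MathematicalPhysics.QuantumManyBody.BoseGas

namespace Summit.AtomisticToContinuum.BoseEinsteinCondensation.Theorems.LaplaceCapUnion

variable {ι : Type*} [Fintype ι] {N : ℕ}

/-! ### Expansion of `F(u_c)` as an antiholomorphic form -/

/-- Pointwise expansion `∏ⱼ conj(∑ᵢ cᵢ eᵢ(xⱼ)) = ∑_f (∏ⱼ conj c_{f j}) ∏ⱼ conj e_{f j}(xⱼ)`. [folklore] -/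
theorem prod_conj_sum_mul_eq [DecidableEq ι] (e : ι → Space → ℂ) (c : ι → ℂ) (X : Config N) :
    (∏ j, conj (∑ i, c i * e i (X j))) =
      ∑ f : Fin N → ι, (∏ j, conj (c (f j))) * ∏ j, conj (e (f j) (X j)) := by
  simp_rw [map_sum, map_mul]
  rw [Finset.prod_univ_sum]
  simp only [Fintype.piFinset_univ]
  refine Finset.sum_congr rfl fun f _ => ?_
  rw [Finset.prod_mul_distrib]

/-- **Expansion.** `F(u_c) = ∑_{f : Fin N → ι} (∏ⱼ conj c_{f j}) A_f` with
`A_f = ∫_{Λ^N} ∏ⱼ conj e_{f j}(xⱼ) Ψ(X) dX`, for continuous modes and `Ψ`. [folklore] -/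
theorem form_expansion [DecidableEq ι] (e : ι → Space → ℂ) (he : ∀ i, Continuous (e i))
    {ψ : Config N → ℂ} (hψ : Continuous ψ) (L : ℝ) (c : ι → ℂ) :
    ∫ X in cellN N L, (∏ j, conj (∑ i, c i * e i (X j))) * ψ X =
      ∑ f : Fin N → ι, (∏ j, conj (c (f j))) * ∫ X in cellN N L, (∏ j, conj (e (f j) (X j))) * ψ X := by
  have hpt : ∀ X : Config N, (∏ j, conj (∑ i, c i * e i (X j))) * ψ X =
      ∑ f : Fin N → ι, (∏ j, conj (c (f j))) * ((∏ j, conj (e (f j) (X j))) * ψ X) := by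
    intro X
    rw [prod_conj_sum_mul_eq, Finset.sum_mul]
    refine Finset.sum_congr rfl fun f _ => ?_
    ring
  simp_rw [hpt]
  have hint : ∀ f : Fin N → ι,
      Integrable (fun X : Config N => (∏ j, conj (e (f j) (X j))) * ψ X)
        (volume.restrict (cellN N L)) := fun f =>
    integrableOn_cellN ((continuous_finsetProd _ fun j _ =>
      Complex.continuous_conj.comp ((he (f j)).comp (continuous_apply j))).mul hψ) L
  rw [integral_finsetSum _ fun f _ => (hint f).const_mul _]
  refine Finset.sum_congr rfl fun f _ => ?_
  exact integral_const_mul _ _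

/-! ### Positivity domination `|F(g)| ≤ F(|g|)` -/

/-- For `Ψ ≥ 0` pointwise (`Ψ = |Ψ|`), `|∫ ∏ⱼ conj g(xⱼ) Ψ| ≤ |∫ ∏ⱼ |g(xⱼ)| Ψ|`
(triangle inequality for the Bochner integral). [folklore] -/
theorem norm_form_integral_le_abs {ψ : Config N → ℂ} (hψ : ∀ X, ψ X = ((‖ψ X‖ : ℝ) : ℂ))
    (g : Space → ℂ) (L : ℝ) :
    ‖∫ X in cellN N L, (∏ j, conj (g (X j))) * ψ X‖ ≤
      ‖∫ X in cellN N L, (∏ j, conj (((‖g (X j)‖ : ℝ) : ℂ))) * ψ X‖ := by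
  have hreal : ∫ X in cellN N L, (∏ j, conj (((‖g (X j)‖ : ℝ) : ℂ))) * ψ X =
      (((∫ X in cellN N L, (∏ j, ‖g (X j)‖) * ‖ψ X‖ : ℝ)) : ℂ) := by
    rw [← integral_complex_ofReal]
    refine integral_congr_ae (Filter.Eventually.of_forall fun X => ?_)
    beta_reduce
    conv_lhs => rw [hψ X]
    simp only [Complex.conj_ofReal]
    push_cast
    ring
  have hnorm : ∀ X : Config N, ‖(∏ j, conj (g (X j))) * ψ X‖ = (∏ j, ‖g (X j)‖) * ‖ψ X‖ := by
    intro X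
    rw [norm_mul, norm_prod]
    simp only [Complex.norm_conj]
  rw [hreal, Complex.norm_real, Real.norm_eq_abs]
  refine (norm_integral_le_integral_norm _).trans ?_
  simp_rw [hnorm]
  exact le_abs_self _

/-! ### Measurability in the coefficients -/

/-- The constant mode is measurable. [folklore] -/
theorem measurable_constantMode (L : ℝ) : Measurable (constantMode L) := by
  unfold constantMode
  exact measurable_const.indicator (measurableSet_cell L)

/-- Joint measurability of `(c, a) ↦ |u_c(π a)|` (as a complex number), for a measurable
`π : α → ℝ³`. [folklore] -/
theorem measurable_norm_sum_mul {α : Type*} [MeasurableSpace α] (e : ι → Space → ℂ)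
    (he : ∀ i, Measurable (e i)) {π : α → Space} (hπ : Measurable π) :
    Measurable fun p : (ι → ℂ) × α => (((‖∑ i, p.1 i * e i (π p.2)‖ : ℝ)) : ℂ) := by
  have h1 : Measurable fun p : (ι → ℂ) × α => ∑ i, p.1 i * e i (π p.2) :=
    Finset.measurable_sum (f := fun i (p : (ι → ℂ) × α) => p.1 i * e i (π p.2)) Finset.univ
      fun i _ => ((measurable_pi_apply i).comp measurable_fst).mul
        ((he i).comp (hπ.comp measurable_snd))
  exact Complex.measurable_ofReal.comp h1.norm

/-- `c ↦ F(|u_c|)` is measurable. [folklore] -/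
theorem measurable_form_integral_abs (e : ι → Space → ℂ) (he : ∀ i, Measurable (e i))
    {ψ : Config N → ℂ} (hψm : Measurable ψ) (L : ℝ) :
    Measurable fun c : ι → ℂ =>
      ∫ X in cellN N L, (∏ j, conj (((‖∑ i, c i * e i (X j)‖ : ℝ) : ℂ))) * ψ X := by
  have hsum : ∀ j : Fin N, Measurable fun p : (ι → ℂ) × Config N => ∑ i, p.1 i * e i (p.2 j) :=
    fun j => Finset.measurable_sum (f := fun i (p : (ι → ℂ) × Config N) => p.1 i * e i (p.2 j))
      Finset.univ fun i _ => ((measurable_pi_apply i).comp measurable_fst).mul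
        ((he i).comp ((measurable_pi_apply j).comp measurable_snd))
  have hterm : ∀ j : Fin N, Measurable fun p : (ι → ℂ) × Config N =>
      conj (((‖∑ i, p.1 i * e i (p.2 j)‖ : ℝ) : ℂ)) := fun j =>
    Complex.continuous_conj.measurable.comp (Complex.measurable_ofReal.comp (hsum j).norm)
  have hm : Measurable fun p : (ι → ℂ) × Config N =>
      (∏ j, conj (((‖∑ i, p.1 i * e i (p.2 j)‖ : ℝ) : ℂ))) * ψ p.2 :=
    (Finset.measurable_prod (f := fun j (p : (ι → ℂ) × Config N) =>
      conj (((‖∑ i, p.1 i * e i (p.2 j)‖ : ℝ) : ℂ))) Finset.univ fun j _ => hterm j).mul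
      (hψm.comp measurable_snd)
  exact (StronglyMeasurable.integral_prod_right
    (f := fun (c : ι → ℂ) (X : Config N) => (∏ j, conj (((‖∑ i, c i * e i (X j)‖ : ℝ) : ℂ))) * ψ X)
    (ν := volume.restrict (cellN N L)) (by exact hm.stronglyMeasurable)).measurable

/-- `c ↦ ⟨|u_c|, φ₀⟩ = ∫_Λ conj|u_c| φ₀` is measurable. [folklore] -/
theorem measurable_ov_abs (e : ι → Space → ℂ) (he : ∀ i, Measurable (e i)) (L : ℝ) :
    Measurable fun c : ι → ℂ =>
      ∫ x in cell L, conj (((‖∑ i, c i * e i x‖ : ℝ) : ℂ)) * constantMode L x := by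
  have hm : Measurable fun p : (ι → ℂ) × Space =>
      conj (((‖∑ i, p.1 i * e i p.2‖ : ℝ) : ℂ)) * constantMode L p.2 :=
    (Complex.continuous_conj.measurable.comp (measurable_norm_sum_mul e he measurable_id)).mul
      ((measurable_constantMode L).comp measurable_snd)
  exact (StronglyMeasurable.integral_prod_right
    (f := fun (c : ι → ℂ) (x : Space) => conj (((‖∑ i, c i * e i x‖ : ℝ) : ℂ)) * constantMode L x)
    (ν := volume.restrict (cell L)) (by exact hm.stronglyMeasurable)).measurable

/-! ### The plane-wave modes of the cube `|n_k| ≤ R` -/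

section PlaneWaves

variable {L : ℝ} {R : ℕ}

/-- The momentum `nᵢ = i - R ∈ ℤ³` of the cube index `i` vanishes exactly at the centre
`i₀ = (R, R, R)`. [folklore] -/
theorem modeIndex_eq_zero_iff (i : Fin 3 → Fin (2 * R + 1)) :
    (fun k => ((i k : ℕ) : ℤ) - (R : ℤ)) = 0 ↔ i = fun _ => ⟨R, by omega⟩ := by
  constructor
  · intro h
    funext k
    have hk := congr_fun h k
    simp only [Pi.zero_apply, sub_eq_zero] at hk
    ext
    exact_mod_cast hk
  · rintro rfl
    funext k
    simp

/-- `∫_Λ e_{-nᵢ} = [i = i₀] L³`. [folklore] -/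
theorem integral_cell_cellWave_neg_modeIndex (hL : 0 < L) (i : Fin 3 → Fin (2 * R + 1)) :
    ∫ x in cell L, cellWave L (-fun k => ((i k : ℕ) : ℤ) - (R : ℤ)) x =
      if i = fun _ => ⟨R, by omega⟩ then (L : ℂ) ^ 3 else 0 := by
  by_cases hi : i = fun _ => ⟨R, by omega⟩
  · rw [if_pos hi, (modeIndex_eq_zero_iff i).2 hi, neg_zero, integral_cell_cellWave_zero hL]
  · rw [if_neg hi]
    refine integral_cell_cellWave_eq_zero hL ?_
    rw [Ne, neg_eq_zero]
    exact fun h => hi ((modeIndex_eq_zero_iff i).1 h)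

/-- `(√(L³))⁻¹ (√(L³))⁻¹ = (L³)⁻¹` in `ℂ`. [folklore] -/
theorem inv_sqrt_cube_mul_self (hL : 0 < L) :
    ((Real.sqrt (L ^ 3) : ℂ))⁻¹ * ((Real.sqrt (L ^ 3) : ℂ))⁻¹ = (((L : ℂ) ^ 3))⁻¹ := by
  rw [← mul_inv, ← Complex.ofReal_mul, Real.mul_self_sqrt (by positivity)]
  push_cast
  ring

/-- **The constant-mode overlap of `u_c`**: `∫_Λ conj(u_c) φ₀ = conj c_{i₀}` for the normalised
plane waves `eᵢ = e_{nᵢ}/√(L³)` (orthonormality on the cell). [folklore] -/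
theorem ov_sum_modes (hL : 0 < L) (c : (Fin 3 → Fin (2 * R + 1)) → ℂ) :
    ∫ x in cell L, conj (∑ i, c i *
        (cellWave L (fun k => ((i k : ℕ) : ℤ) - (R : ℤ)) x / (Real.sqrt (L ^ 3) : ℂ))) *
      constantMode L x = conj (c fun _ => ⟨R, by omega⟩) := by
  set s : ℂ := (Real.sqrt (L ^ 3) : ℂ) with hs_def
  have hs0 : s ≠ 0 := by
    rw [hs_def, Complex.ofReal_ne_zero]
    exact (Real.sqrt_pos.2 (by positivity)).ne'
  have hcm : ∀ x ∈ cell L, constantMode L x = s⁻¹ := fun x hx => by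
    simp [constantMode, Set.indicator_of_mem hx, hs_def]
  rw [setIntegral_congr_fun (measurableSet_cell L) (fun x hx => by rw [hcm x hx])]
  have hpt : ∀ x : Space, conj (∑ i, c i * (cellWave L (fun k => ((i k : ℕ) : ℤ) - (R : ℤ)) x / s)) * s⁻¹ =
      ∑ i, conj (c i) * ((s⁻¹ * s⁻¹) * cellWave L (-fun k => ((i k : ℕ) : ℤ) - (R : ℤ)) x) := by
    intro x
    rw [map_sum, Finset.sum_mul]
    refine Finset.sum_congr rfl fun i _ => ?_
    rw [map_mul, map_div₀, conj_cellWave, hs_def, Complex.conj_ofReal]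
    field_simp
  simp_rw [hpt]
  have hint : ∀ i : Fin 3 → Fin (2 * R + 1), Integrable
      (fun x => conj (c i) * ((s⁻¹ * s⁻¹) * cellWave L (-fun k => ((i k : ℕ) : ℤ) - (R : ℤ)) x))
      (volume.restrict (cell L)) := fun i =>
    (integrableOn_cell ((continuous_cellWave L _))).const_mul _ |>.const_mul _
  rw [integral_finsetSum _ fun i _ => hint i]
  simp_rw [integral_const_mul, integral_cell_cellWave_neg_modeIndex hL, mul_ite, mul_zero]
  rw [Finset.sum_ite_eq' Finset.univ (fun _ => (⟨R, by omega⟩ : Fin (2 * R + 1)))]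
  simp only [Finset.mem_univ, if_true]
  rw [hs_def, inv_sqrt_cube_mul_self hL, inv_mul_cancel₀ (pow_ne_zero 3 (Complex.ofReal_ne_zero.2 hL.ne')),
    mul_one]

/-- The centre mode is the constant mode on the cell: `e_{i₀}(x) = 1/√(L³)`. [folklore] -/
theorem centre_mode_apply (L : ℝ) (R : ℕ) (x : Space) :
    cellWave L (fun k => ((((fun _ => (⟨R, by omega⟩ : Fin (2 * R + 1))) k : ℕ) : ℤ)) - (R : ℤ)) x /
      (Real.sqrt (L ^ 3) : ℂ) = ((Real.sqrt (L ^ 3) : ℂ))⁻¹ := by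
  have : (fun k : Fin 3 => ((((fun _ => (⟨R, by omega⟩ : Fin (2 * R + 1))) k : ℕ) : ℤ)) - (R : ℤ)) = 0 := by
    funext k; simp
  rw [this, cellWave_zero, one_div]

/-- **The top coefficient is `F(φ₀)`**: `A_{(i₀,…,i₀)} = ∫_{Λ^N} ∏ⱼ conj φ₀(xⱼ) Ψ`. [folklore] -/
theorem form_coeff_centre (L : ℝ) (R : ℕ) (ψ : Config N → ℂ) :
    ∫ X in cellN N L, (∏ j : Fin N, conj (cellWave L
        (fun k => ((((fun _ => (⟨R, by omega⟩ : Fin (2 * R + 1))) k : ℕ) : ℤ)) - (R : ℤ)) (X j) /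
          (Real.sqrt (L ^ 3) : ℂ))) * ψ X =
      ∫ X in cellN N L, (∏ j, conj (constantMode L (X j))) * ψ X := by
  refine setIntegral_congr_fun (measurableSet_cellN N L) fun X hX => ?_
  simp only [centre_mode_apply]
  congr 2
  funext j
  rw [show constantMode L (X j) = ((Real.sqrt (L ^ 3) : ℂ))⁻¹ by
    simp [constantMode, Set.indicator_of_mem (hX j)]]

/-- **`F(φ₀) ≠ 0` for a nonnegative normalised state**: `∫_{Λ^N} ∏ⱼ conj φ₀(xⱼ) Ψ =
(√(L³))^{-N} ∫_{Λ^N} Ψ > 0`. [folklore] -/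
theorem form_constantMode_ne_zero (hL : 0 < L) (Ψ : PeriodicTrialState N L)
    (hΨ : ∀ X, Ψ.ψ X = ((‖Ψ.ψ X‖ : ℝ) : ℂ)) :
    ∫ X in cellN N L, (∏ j, conj (constantMode L (X j))) * Ψ.ψ X ≠ 0 := by
  set s : ℂ := (Real.sqrt (L ^ 3) : ℂ) with hs_def
  have hs0 : s ≠ 0 := by
    rw [hs_def, Complex.ofReal_ne_zero]
    exact (Real.sqrt_pos.2 (by positivity)).ne'
  have hpt : ∀ X ∈ cellN N L, (∏ j, conj (constantMode L (X j))) * Ψ.ψ X =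
      (conj s⁻¹) ^ N * (((‖Ψ.ψ X‖ : ℝ)) : ℂ) := by
    intro X hX
    have : ∀ j, constantMode L (X j) = s⁻¹ := fun j => by
      simp [constantMode, Set.indicator_of_mem (hX j), hs_def]
    simp only [this, Finset.prod_const, Finset.card_univ, Fintype.card_fin]
    rw [← hΨ X]
  rw [setIntegral_congr_fun (measurableSet_cellN N L) hpt, integral_const_mul, integral_complex_ofReal]
  refine mul_ne_zero (pow_ne_zero _ ?_) ?_
  · rwa [Ne, map_eq_zero, inv_eq_zero]
  rw [Ne, Complex.ofReal_eq_zero]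
  intro h0
  have hcont : Continuous Ψ.ψ := Ψ.contDiff.continuous
  have hint : Integrable (fun X => ‖Ψ.ψ X‖) (volume.restrict (cellN N L)) :=
    (integrableOn_cellN hcont L).norm
  have hae := (integral_eq_zero_iff_of_nonneg (fun X => norm_nonneg _) hint).1 h0
  have hzero : ∫⁻ X in cellN N L, (‖Ψ.ψ X‖₊ : ℝ≥0∞) ^ 2 = 0 := by
    rw [lintegral_eq_zero_iff' (hcont.measurable.nnnorm.coe_nnreal_ennreal.pow_const 2).aemeasurable]
    filter_upwards [hae] with X hX
    simp only [Pi.zero_apply, norm_eq_zero] at hX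
    simp [hX]
  have h1 := Ψ.norm_eq
  rw [hzero] at h1
  exact zero_ne_one h1

end PlaneWaves

end Summit.AtomisticToContinuum.BoseEinsteinCondensation.Theorems.LaplaceCapUnion
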